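import Literature.MathematicalPhysics.QuantumFieldTheory.Balaban1983to89.B1

/-!
# `Balaban1983to89.B2Eq299Expansion` — [Balaban1982Higgs2] (2.99) p. 577: the expansion of
`Δ^{(j)}(Ω, A+B) + aL⁻²P_{A+B}` *"using the formulas (I.3.15), (I.3.44)"* that DEFINES `W^{(j)}(A,B)` — KERNEL-CHECKED in an
arbitrary *-ring (style of `B1.display316` / `B1.display344_of_316`), with the printed sign of the `F_{2,j}G_jF*_{2,j}` term
DECIDED (it is a print slip: the identity holds with `+`, and fails as printed already for real numbers)

statement-level skeleton of published theorems with citation tags; proofs where landed; nothing here is a claim about the Yang–Mills mass gap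

CITATION HEADER.  T. Bałaban, *(Higgs)₂,₃ quantum fields in a finite volume. II. An upper bound*, Commun. Math. Phys. **86**
(1982) 555–594, doi:10.1007/bf01214890 [Balaban1982Higgs2] (cell paper B2; PDF held `paper:balaban1982-cmp86-higgs23-ii`,
journal page = PDF page + 554; p. 577 READ AS AN IMAGE on the ×2/×4 renders `run/shared/lean/pub/pub-balaban/b2b-balaban-ref1/
pages/1982-cmp86-higgs23-II/…-p023-x2.png`, `…-p023-x4.png`).  Unit `lit-balaban-p04` gen 3 (Phase-2 proof seat; HOME
`run/shared/lean/pub/lit-balaban/`); SKELETON row **B2.Eq2.103** (members (2.99)–(2.107)), member **(2.99)**; the members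
(2.100)–(2.103) are `…B1Eq346DetFactorization` (p244403) / `…B2Ineq2103LogDet` (p244583), where (2.99) enters only through
its LAST equality `C₁⁻¹ = C₀⁻¹ − W^{(j)}` (the definition of `W^{(j)}`), which is unaffected by the slip decided here.
Referee ref-4; owners r02/r14 (B2), reader r13 (§3 part 2).

WHAT IS PRINTED (verbatim, p. 577 [PDF 23]).  *"Now we will expand the operator (C^{(j)}_{Λ₅^{(j)}}(B^j(Λ₂^{(j)}), B̃ + Ã))⁻¹
with respect to the field Ã. We use the formulas (I.3.15), (I.3.44) for the expansions of Q_j(A + B), G_j(Ω, A + B) and we get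
Δ^{(j)}(Ω, A + B) + aL⁻²P_{A+B} = a_jI − a_j²Q_j(A + B)G_j(Ω, A + B)Q_j*(A + B) + aL⁻²P_{A+B}
= Δ^{(j)}(Ω, B) + aL⁻²P_B + aL⁻²Q*(B)F₂(A, B) + aL⁻²F₂*(A, B)Q(B) + aL⁻²F₂*(A, B)F₂(A, B)
− a_j²F_{2,j}(A, B)G_j(Ω, A + B)Q_j*(A + B) − a_j²Q_j(A + B)G_j(Ω, A + B)F*_{2,j}(A, B) − a_j²F_{2,j}(A, B)G_j(Ω, A + B)F*_{2,j}(A, B)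
− a_j²Q_j(B)G_j(Ω, B)V_j(A, B)G_j(Ω, A + B)Q_j*(B) =: Δ^{(j)}(Ω, B) + aL⁻²P_B − W^{(j)}(A, B). (2.99)
The operator W^{(j)} is built with the help of the propagator G_j(B^j(Λ₂^{(j)}), Ã + B̃), so (2.99) does not give a full expansion
in A, which will be obtained later."*  The printed reasons: (I.3.15) `Q_k(A + B) = Q_k(B) + F_{2,k}(A, B)` ([Balaban1982Higgs1]
p. 614; kernel `B1.display315`), used at level j (`Q_j`, `F_{2,j}`) and for the next averaging `Q`, `F₂` (`P_X = Q*(X)Q(X)`);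
(I.3.44) `G_k(Ω, A + B) = G_k(Ω, B) + G_k(Ω, B)V_kG_k(Ω, A + B)` (p. 619; kernel `B1.display344_of_316`).

THE FINDING.  With `Q′ := Q_j(A+B) = Q + F` (`Q := Q_j(B)`, `F := F_{2,j}`) and `G′ := G_j(Ω, A+B)`:
`Q′G′Q′* = QG′Q* + FG′Q′* + Q′G′F* − FG′F*` (the two mixed terms, written — as printed — with `Q_j(A + B)`, both contain
`FG′F*`, so ONE copy must be SUBTRACTED), and `QG′Q* = QG(Ω,B)Q* + QG(Ω,B)V_jG′Q*` by (I.3.44).  Hence the correct expansion has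
`… − a_j²FG′Q′* − a_j²Q′G′F* + a_j²FG′F* − a_j²QGV_jG′Q*`: the printed `−a_j²F_{2,j}G_jF*_{2,j}` carries the wrong sign (the
difference between the two sides of the printed display is `2a_j²F_{2,j}G_j(Ω, A+B)F*_{2,j}`).  Harmless for the paper:
`W^{(j)}` is DEFINED by the last equality of (2.99), and what is used afterwards ((2.100)–(2.103), the estimates p. 578) is
`C(B̃ + Ã)⁻¹ = C(B̃)⁻¹ − W^{(j)}` together with the STRUCTURE of `W^{(j)}` (one-loop terms, the propagator `G_j(Ω, A+B)`), not
the sign of this term.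

DICTIONARY (arbitrary *-ring `𝔄` ↤ operators on the fields over Λ₅^{(j)}, `star` ↤ adjoint; scalars are ring elements):
`aj` ↤ a_j, `b` ↤ aL⁻², `qB` ↤ Q_j(B), `qAB` ↤ Q_j(A + B), `f` ↤ F_{2,j}(A, B) (`hQj`: (I.3.15) at level j), `gB` ↤ G_j(Ω, B),
`gAB` ↤ G_j(Ω, A + B), `v` ↤ V_j(A, B) (`h344`: (I.3.44)), `QB` ↤ Q(B), `QAB` ↤ Q(A + B), `F2` ↤ F₂(A, B) (`hQ`: (I.3.15) for
the next averaging), `P_X = star QX * QX`, `Δ^{(j)}(Ω, X) = aj − aj²·qX·gX·star qX` (the first printed equality of (2.99)).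
THEOREMS ONLY (no `def`, no new `Prop` fact); axioms standard.

WHAT THIS MODULE PROVES.  `eq299` — (2.99) with the `F_{2,j}G_jF*_{2,j}` sign REPAIRED, in any *-ring, from exactly the printed
reasons; `eq299_W` — the same read as the expansion of `W^{(j)} := (Δ^{(j)}(Ω,B) + aL⁻²P_B) − (Δ^{(j)}(Ω,A+B) + aL⁻²P_{A+B})`;
`not_eq299_printed` — the display AS PRINTED, ∀-quantified over the dictionary with its hypotheses, is FALSE (witness in the
*-ring `ℝ`: `a_j = 1`, `Q_j(B) = 0`, `F_{2,j} = G_j = 1`, `V_j = 0`, next-level operators `0`: left side `0`, printed right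
side `−2`); `eq299_printed_iff` — in any *-ring the printed right side equals the left side iff `2·a_j²FG′F* = 0`.
-/

namespace Literature.MathematicalPhysics.QuantumFieldTheory.Balaban1983to89.B2Eq299Expansion

/-- **(2.99)** p. 577 [PDF 23], KERNEL-CHECKED in an arbitrary *-ring with the sign of the `F_{2,j}G_j(Ω,A+B)F*_{2,j}` term
REPAIRED (`+ a_j²·f·gAB·f*`; see the module docstring): from (I.3.15) at level j (`hQj`), (I.3.15) for the next averaging
(`hQ`) and (I.3.44) (`h344`), term by term in the printed order otherwise. [cite: Balaban1982Higgs2, (2.99) p.577] -/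
theorem eq299 {𝔄 : Type} [Ring 𝔄] [StarRing 𝔄] (aj b qB qAB f gB gAB v QB QAB F2 : 𝔄)
    (hQj : qAB = qB + f) (hQ : QAB = QB + F2) (h344 : gAB = gB + gB * v * gAB) :
    (aj - aj * aj * (qAB * gAB * star qAB)) + b * (star QAB * QAB) =
      (aj - aj * aj * (qB * gB * star qB)) + b * (star QB * QB)
        + b * (star QB * F2) + b * (star F2 * QB) + b * (star F2 * F2)
        - aj * aj * (f * gAB * star qAB) - aj * aj * (qAB * gAB * star f) + aj * aj * (f * gAB * star f)
        - aj * aj * (qB * gB * v * gAB * star qB) := by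
  -- Q_j(B)G_j(Ω,A+B)Q_j*(B) = Q_j(B)G_j(Ω,B)Q_j*(B) + Q_j(B)G_j(Ω,B)V_jG_j(Ω,A+B)Q_j*(B)  by (I.3.44)
  have hG : qB * gAB * star qB = qB * gB * star qB + qB * gB * v * gAB * star qB := by
    conv_lhs => rw [h344]
    noncomm_ring
  subst hQj
  subst hQ
  simp only [star_add, add_mul, mul_add]
  rw [hG]
  noncomm_ring

/-- (2.99) read as the expansion of `W^{(j)}(A,B) := (Δ^{(j)}(Ω,B) + aL⁻²P_B) − (Δ^{(j)}(Ω,A+B) + aL⁻²P_{A+B})` (its defining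
last equality), with the repaired sign: `W^{(j)} = −aL⁻²Q*(B)F₂ − aL⁻²F₂*Q(B) − aL⁻²F₂*F₂ + a_j²F_{2,j}G_jQ_j*(A+B) +
a_j²Q_j(A+B)G_jF*_{2,j} − a_j²F_{2,j}G_jF*_{2,j} + a_j²Q_j(B)G_j(Ω,B)V_jG_jQ_j*(B)`. [cite: Balaban1982Higgs2, (2.99) p.577] -/
theorem eq299_W {𝔄 : Type} [Ring 𝔄] [StarRing 𝔄] (aj b qB qAB f gB gAB v QB QAB F2 : 𝔄)
    (hQj : qAB = qB + f) (hQ : QAB = QB + F2) (h344 : gAB = gB + gB * v * gAB) :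
    ((aj - aj * aj * (qB * gB * star qB)) + b * (star QB * QB))
        - ((aj - aj * aj * (qAB * gAB * star qAB)) + b * (star QAB * QAB)) =
      -(b * (star QB * F2)) - b * (star F2 * QB) - b * (star F2 * F2)
        + aj * aj * (f * gAB * star qAB) + aj * aj * (qAB * gAB * star f) - aj * aj * (f * gAB * star f)
        + aj * aj * (qB * gB * v * gAB * star qB) := by
  rw [eq299 aj b qB qAB f gB gAB v QB QAB F2 hQj hQ h344]
  noncomm_ring

/-- In any *-ring, the right side of (2.99) AS PRINTED (all three `F_{2,j}`-terms with `−`) equals the left side iff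
`2·a_j²F_{2,j}G_j(Ω,A+B)F*_{2,j} = 0` — the exact content of the slip. [cite: Balaban1982Higgs2, (2.99) p.577] -/
theorem eq299_printed_iff {𝔄 : Type} [Ring 𝔄] [StarRing 𝔄] (aj b qB qAB f gB gAB v QB QAB F2 : 𝔄)
    (hQj : qAB = qB + f) (hQ : QAB = QB + F2) (h344 : gAB = gB + gB * v * gAB) :
    ((aj - aj * aj * (qAB * gAB * star qAB)) + b * (star QAB * QAB) =
      (aj - aj * aj * (qB * gB * star qB)) + b * (star QB * QB)
        + b * (star QB * F2) + b * (star F2 * QB) + b * (star F2 * F2)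
        - aj * aj * (f * gAB * star qAB) - aj * aj * (qAB * gAB * star f) - aj * aj * (f * gAB * star f)
        - aj * aj * (qB * gB * v * gAB * star qB)) ↔
      (2 : 𝔄) * (aj * aj * (f * gAB * star f)) = 0 := by
  rw [eq299 aj b qB qAB f gB gAB v QB QAB F2 hQj hQ h344]
  constructor
  · intro h
    have h' := sub_eq_zero.2 h
    rw [← h']
    noncomm_ring
  · intro h
    rw [two_mul] at h
    have : aj * aj * (f * gAB * star f) = -(aj * aj * (f * gAB * star f)) := eq_neg_of_add_eq_zero_left h
    conv_lhs => rw [this]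
    noncomm_ring

/-- **(2.99) AS PRINTED is false**: quantified over exactly the dictionary and the printed reasons, the display fails in the
*-ring `ℝ` (trivial `star`) at `a_j = 1`, `aL⁻² = 0`, `Q_j(B) = 0`, `F_{2,j} = 1` (so `Q_j(A+B) = 1`), `G_j(Ω,B) = G_j(Ω,A+B) = 1`,
`V_j = 0` ((I.3.44) holds), `Q(B) = Q(A+B) = F₂ = 0`: left side `1 − 1 = 0`, printed right side `1 − 1 − 1 − 1 = −2`.
[cite: Balaban1982Higgs2, (2.99) p.577] -/
theorem not_eq299_printed :
    ¬ ∀ (aj b qB qAB f gB gAB v QB QAB F2 : ℝ),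
        qAB = qB + f → QAB = QB + F2 → gAB = gB + gB * v * gAB →
        (aj - aj * aj * (qAB * gAB * star qAB)) + b * (star QAB * QAB) =
          (aj - aj * aj * (qB * gB * star qB)) + b * (star QB * QB)
            + b * (star QB * F2) + b * (star F2 * QB) + b * (star F2 * F2)
            - aj * aj * (f * gAB * star qAB) - aj * aj * (qAB * gAB * star f) - aj * aj * (f * gAB * star f)
            - aj * aj * (qB * gB * v * gAB * star qB) := by
  intro h
  have h1 := h 1 0 0 1 1 1 1 0 0 0 0 (by norm_num) (by norm_num) (by norm_num)
  simp only [star_trivial] at h1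
  norm_num at h1

end Literature.MathematicalPhysics.QuantumFieldTheory.Balaban1983to89.B2Eq299Expansion
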